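import Literature.AlgebraicGeometry.HodgeTheory.UnitaryHodgeGroupSlotsHodgeClasses
import Literature.RepresentationTheory.ClassicalInvariants.MixedTensorLieInvariantsGLColoured
import HarnessLib

/-!
# `Hg = U_E` (E a CM field) ⟹ the Hodge classes on all powers are generated by divisor classes, I: the coloured invariance theorem with the Lie step as a hypothesis (Moonen–Zarhin 1999 (1.8), Hazama / Murty, for `D = E` a CM field; Milne 1999 Prop. 3.6 (c))

Family `hodge`, layer `Literature/AlgebraicGeometry/HodgeTheory`. Research context: cell `pub-hodgeav-hg6` (LADDER-HodgeAV
PERC-SHAPE row 2, «base of HC ladder», req-37 Q2b TABLE X; HONEST FRAMING: nothing here proves HC, HC_AV or HC_CM;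
research route conditional on HC_CM where HC_CM appears — it does not appear here; not a corollary). UNCONDITIONAL for
the class of abelian varieties it names; theorems only, no definition, no named fact (D-0026), no `sorry`. Part I of the
COLOURED socket (sequels: `CMHodgeGroupDualBases`, `CMHodgeGroupPowersHodgeClasses`); the one-colour socket is
`UnitaryHodgeGroupSlotsHodgeClasses` / `UnitaryHodgeGroupPowersHodgeClasses` (this cell's G1).

This is the `ι`-COLOURED, MULTIPLICITY-FREE form of the tree's `QuarticCMTwoOneSlotsHodgeClasses` §3 (two colours
`Fin 2`, quartic CM field, multiplicities `{(1,1),(2,0)}`, Lie step THEOREM L″ of `HodgeThetaSubalgebraUnitaryQuartic`):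
the colour type is an arbitrary finite type `ι` (the places `{σ, σ̄}` of a CM field `E` of degree `2|ι|` acting on
`H¹(A; ℚ)` through a generator `φ`, eigenvalues `μ k` and `conj (μ k)`), the multiplicities are arbitrary, and the Lie
step «`Lie Hg(H¹(A)) ⊗ ℂ ⊇ 𝔲_E(V,ψ) ⊗ ℂ ≅ ∏_k 𝔤𝔩(W_{μ k})`» is the HYPOTHESIS `hU` — «every `φ_ℂ`-commuting `ψ_ℂ`-skew
operator lies in `Lie Hg ⊗ ℂ`», i.e. `Hg(A) = U_E(V, ψ)` (MZ99 (2.3): «`Hg(X) = U_F(V,ψ)`») —, fed to THEOREM L′ under `hU`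
(`UnitaryTheta.wordDerAt_eq_zero_of_commute_of_skew_of_hodgeLieC`, G1, valid for any `φ`). CREDIT: the 200-line letter
transport below is COPIED from `AVSlots.exists_quarticInvariant_coeff` (cell pub-hodge-ring2, programme R10) with
`Fin 2 ↦ ι` and its one Lie line replaced; nothing else is re-proved. The quartic theorem is the instance `ι = Fin 2`,
`hU :=` THEOREM L″ (library debt, not refiled).

THE PRINT. Moonen–Zarhin 1999 (1.8) [corpus: paper:arxiv-math_9901113 p0004 L72–88]: «the Hodge group `Hg(X)` is
contained in the algebraic group `Sp_D(V,φ)` [the centralizer of `D = End⁰(X)` in `Sp(V,φ)`]. It was shown by Hazama and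
Murty (independently) that `Hg(X) = Sp_D(V,φ)` ⟺ (`X` has no factors of type III and `D(Xⁿ) = B(Xⁿ)` for all `n`).» For
`D = E` a CM field, `Sp_E(V,φ) = U_E(V,ψ)` (ibid. (2.3)), whose complex points are `∏_σ GL(W_σ)` over half the embeddings
(Deligne LNM 900 §4: `H¹ ⊗ ℂ = ⊕_σ H¹_σ`, `ψ` pairs `H¹_σ` with `H¹_σ̄`; Milne 1999 §2: «the standard representation and its
contragredient», per place).

MAIN RESULT. `AVSlots.exists_cmInvariant_coeff_of_hodgeLieC` — every rational `(p,p)`-class on an abelian variety `B`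
with slots over `A` is `∑_w a(w)·(g cb)_w` for a coefficient function `a` on words in the letters `((j, (k, t)), ℓ)`
(slot, colour, type, index) whose slices are killed, for each colour `k` and EVERY `X ∈ 𝔤𝔩_{n₀}(ℂ)`, by the typed
differential of `X` placed at the positions of colour `k` (`X` at type `0`, `-Xᵀ` at type `1`, `0` elsewhere).

## References

* [MoonenZarhin1999LowDim] B. Moonen, Yu. Zarhin, *Hodge classes on abelian varieties of low dimension*, Math. Ann.
  315 (1999) = arXiv:math/9901113 (held `paper:arxiv-math_9901113`), §1 (1.8), §2 (2.3), §3 (3.1).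
* [Hazama1983] F. Hazama, Tôhoku Math. J. 35 (1983), Thm. (1.1), §3 pp. 305–306.
* [Murty1984] V. K. Murty, *Exceptional Hodge classes on certain abelian varieties*, Math. Ann. 268 (1984), Thm. 3.1, §3.
* [Deligne1982HodgeCycles] P. Deligne, *Hodge cycles on abelian varieties*, LNM 900 (1982), I §3 Prop. 3.4, §4 (p. 30).
* [Milne1999LefschetzClasses] J. S. Milne, *Lefschetz classes on abelian varieties*, Duke Math. J. 96 (1999), §2 p. 651, Prop. 3.6 (c).
* [Gordon1997] B. B. Gordon, *A survey of the Hodge conjecture for abelian varieties*, arXiv:alg-geom/9709030, §6 pp. 18–19.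
* [GoodmanWallachGTM255] R. Goodman, N. R. Wallach, GTM 255 (2009), §4.1.1.
* [FultonYoungTableaux1997] W. Fulton, *Young Tableaux* (1997), §8.1.
-/

noncomputable section

open scoped TensorProduct
open scoped Matrix
open CategoryTheory Module

/-! ### §1 The coloured invariance theorem under `Hg = U_E`: slices are killed by `∏_k 𝔤𝔩(W_{μ k})` acting by `X ⊕ (-Xᵀ)` on its colour -/

namespace Literature.AlgebraicGeometry.HodgeTheory

open Literature.AlgebraicTopology.SingularHomology
open Literature.AlgebraicGeometry.Motives (IsSmoothProjective AbelianVariety bettiCohomology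
  ofRatClassBaseChange ofRatClassBaseChange_tmul HodgeTensorFacts hodgeTensorFacts_holds)
open Literature.Barriers.HodgeConjecture
open Literature.AlgebraicGeometry.Motives.HodgeStructure
open Literature.RepresentationTheory.GeneralLinear
open Literature.RepresentationTheory.ClassicalInvariants
open Literature.NumberTheory.DiophantineGeometry

section CMInvariance

variable {A B : AbelianVariety ℂ} {n : ℕ} {g : Fin n → (B ⟶ A)} {ι : Type} [Fintype ι] [DecidableEq ι]

/-- The two elements of `Fin 2`. [folklore] -/
private theorem fin2_cases' (r : Fin 2) : r = 0 ∨ r = 1 := by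
  fin_cases r <;> simp

open scoped Classical in
/-- **THE COLOURED INVARIANCE THEOREM under `Hg = U_E` (MZ99 (1.8) for `D = E` a CM field, Lie step as hypothesis; any
multiplicities).** Let `A` be a complex abelian variety whose `H = H¹(A(ℂ); ℚ)` carries a polarization `ψ` and
`φ ∈ End_Hdg(H)` such that `Lie Hg(H) ⊗ ℂ` contains every `φ_ℂ`-commuting `ψ_ℂ`-skew operator (`hU`); let `μ : ι → ℂ`
(half the eigenvalues of `φ_ℂ`, one per pair of conjugate places) and `cb ((k,t),ℓ)` be adapted `ψ_ℂ`-dual bases —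
`cb((k,0),ℓ) ∈ W_{μ k}`, `cb((k,1),ℓ) ∈ W_{conj μ k}`, of pure Hodge types (kinds `κ`), pairing table `δ_{kk'}δ_{ij}` across
types and `0` on equal types (`CMTheta.exists_adaptedDualBasis` of the sequel) —, and `B` an abelian variety with slots
`g` over `A`. Then every rational `(p,p)`-class `c` on `B` (`p ≥ 1`) is `∑_w a(w) · (g cb)_w` for a coefficient function
`a` on words in the letters `((j, (k, t)), ℓ)` such that for every slot-colour-type word `U`, every colour `k` and EVERY
`X ∈ 𝔤𝔩_{n₀}(ℂ)` the typed differential of `X` at the positions of colour `k` (`X` at type `0`, `-Xᵀ` at type `1`, `0`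
at the other colours) kills the slice `a(U, −)`: the operator `Y_{k,X}` with this block matrix in the letters commutes
with `φ_ℂ` (blockwise scalars) and is `ψ_ℂ`-skew (the pairing table), so THEOREM L′ under `hU` applies. The letter
transport is VERBATIM that of the tree's `AVSlots.exists_quarticInvariant_coeff` (two colours), which is the instance
`ι = Fin 2`, `hU :=` THEOREM L″. Deligne §4: `E ⊗ ℂ = ℂ^{Hom(E,ℂ)}` acts on `H¹_σ` through `σ`.
[cite: MoonenZarhin1999LowDim, §1 (1.8), §2 (2.3) and §3 (3.1)] [cite: Deligne1982HodgeCycles, §4 (p. 30)]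
[cite: Gordon1997, §6 (proof of Thm. 6.3.3, pp. 18–19)] [cite: Milne1999LefschetzClasses, §2 p. 651] -/
theorem AVSlots.exists_cmInvariant_coeff_of_hodgeLieC [HodgeTensorFacts.{0, 0}] (hg : AVSlots A B g)
    (hHD : exists_isReal_hodgeModel) (hI : hodgePQ_independent_of_hodgeModel)
    (ψ : (BettiUniverse.hodge hHD (AbelianVariety.isSmoothProjective_holds (A := A)) 1).Polarization)
    {φ : Module.End ℚ (bettiCohomology A.X 1)}
    (hU : ∀ Y : Module.End ℂ (ℂ ⊗[ℚ] bettiCohomology A.X 1), Y * φ.baseChange ℂ = φ.baseChange ℂ * Y →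
      (∀ x y, ψ.form.baseChange ℂ (Y x) y + ψ.form.baseChange ℂ x (Y y) = 0) →
        Y ∈ (BettiUniverse.hodge hHD (AbelianVariety.isSmoothProjective_holds (A := A)) 1).hodgeLieC)
    (μ : ι → ℂ) {n₀ : ℕ} (cb : Module.Basis ((ι × Fin 2) × Fin n₀) ℂ (ℂ ⊗[ℚ] bettiCohomology A.X 1))
    (κ : ι × Fin n₀ → Fin 2)
    (hcbW : ∀ k ℓ, cb ((k, 0), ℓ) ∈ Module.End.eigenspace (φ.baseChange ℂ) (μ k))
    (hcbW' : ∀ k ℓ, cb ((k, 1), ℓ) ∈ Module.End.eigenspace (φ.baseChange ℂ) (starRingEnd ℂ (μ k)))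
    (hcb0 : ∀ k ℓ, κ (k, ℓ) = 0 →
      cb ((k, 0), ℓ) ∈ (BettiUniverse.hodge hHD (AbelianVariety.isSmoothProjective_holds (A := A)) 1).piece 1 0 ∧
      cb ((k, 1), ℓ) ∈ (BettiUniverse.hodge hHD (AbelianVariety.isSmoothProjective_holds (A := A)) 1).piece 0 1)
    (hcb1 : ∀ k ℓ, κ (k, ℓ) = 1 →
      cb ((k, 0), ℓ) ∈ (BettiUniverse.hodge hHD (AbelianVariety.isSmoothProjective_holds (A := A)) 1).piece 0 1 ∧
      cb ((k, 1), ℓ) ∈ (BettiUniverse.hodge hHD (AbelianVariety.isSmoothProjective_holds (A := A)) 1).piece 1 0)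
    (hdual : ∀ k k' i j, ψ.form.baseChange ℂ (cb ((k, 0), i)) (cb ((k', 1), j)) =
      if k = k' ∧ i = j then 1 else 0)
    (hiso : ∀ k k' (t : Fin 2) i j, ψ.form.baseChange ℂ (cb ((k, t), i)) (cb ((k', t), j)) = 0)
    {p : ℕ} (hp : 0 < p) {c : complexBetti B.X (2 * p)} (hcQ : IsRationalClass c)
    (hc : IsOfHodgeType B.dim B.X (2 * p) p p c) :
    ∃ a : (Fin (2 * p) → (Fin n × (ι × Fin 2)) × Fin n₀) → ℂ,
      wordEval (cupPowOneAlt ℂ (Motives.ComplexPoints B.X) (2 * p))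
        (fun x : (Fin n × (ι × Fin 2)) × Fin n₀ => avLetters g (fun tl : (ι × Fin 2) × Fin n₀ =>
          ofRatClassBaseChange (Motives.ComplexPoints A.X) 1 (cb tl)) (x.1.1, (x.1.2, x.2))) a = c ∧
      ∀ (U : Fin (2 * p) → Fin n × (ι × Fin 2)) (k : ι) (X : Matrix (Fin n₀) (Fin n₀) ℂ),
        wordDerAt ℂ (fun t => if (U t).2.1 = k then (if (U t).2.2 = 0 then X else -Xᵀ) else 0)
          (wordSlice a U) = 0 := by
  classical
  -- (the letter transport below is that of `AVSlots.exists_quarticInvariant_coeff`, cell pub-hodge-ring2, R10)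
  -- the setting
  have hX : IsSmoothProjective A.dim A.X := AbelianVariety.isSmoothProjective_holds
  haveI : Module.Finite ℚ (bettiCohomology A.X 1) := finite_bettiCohomology_one A
  have hn1 : (((1 : ℕ) : ℤ)) = 1 := Nat.cast_one
  have heff := BettiUniverse.hodge_isEffective hHD hX 1
  set F := cupPowOneAlt ℂ (Motives.ComplexPoints B.X) (2 * p) with hFdef
  have hFinj : Function.Injective (exteriorPower.alternatingMapLinearEquiv F) :=
    injective_alternatingMapLinearEquiv_cupPowOneAlt B (2 * p)
  -- bases: the adapted basis `cbσ` and the rational basis `eC`, both indexed by `Fin M`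
  set eQ := Module.finBasis ℚ (bettiCohomology A.X 1) with heQ
  set eC : Module.Basis (Fin (Module.finrank ℚ (bettiCohomology A.X 1))) ℂ
    (ℂ ⊗[ℚ] bettiCohomology A.X 1) := Algebra.TensorProduct.basis ℂ eQ with heC
  set φι : Fin (Module.finrank ℚ (bettiCohomology A.X 1)) ≃ (ι × Fin 2) × Fin n₀ := eC.indexEquiv cb with hφι
  set cbσ : Module.Basis (Fin (Module.finrank ℚ (bettiCohomology A.X 1))) ℂ
    (ℂ ⊗[ℚ] bettiCohomology A.X 1) := cb.reindex φι.symm with hcbσdef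
  have hcbσ : ∀ m, cbσ m = cb (φι m) := fun m => by
    rw [hcbσdef, Module.Basis.reindex_apply, Equiv.symm_symm]
  -- kinds of the adapted letters (covectors have the opposite kind)
  set κ2 : (ι × Fin 2) × Fin n₀ → Fin 2 := fun x =>
    if x.1.2 = 0 then κ (x.1.1, x.2) else (if κ (x.1.1, x.2) = 0 then 1 else 0) with hκ2
  have hkind : ∀ x : (ι × Fin 2) × Fin n₀,
      (κ2 x = 0 → cb x ∈ (BettiUniverse.hodge hHD (AbelianVariety.isSmoothProjective_holds (A := A)) 1).piece 1 0) ∧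
      (κ2 x = 1 → cb x ∈ (BettiUniverse.hodge hHD (AbelianVariety.isSmoothProjective_holds (A := A)) 1).piece 0 1) := by
    rintro ⟨⟨k, t⟩, ℓ⟩
    rcases fin2_cases' t with rfl | rfl <;> rcases fin2_cases' (κ (k, ℓ)) with h | h
    · have hk : κ2 ((k, 0), ℓ) = 0 := by simp [hκ2, h]
      rw [hk]
      exact ⟨fun _ => (hcb0 k ℓ h).1, fun h' => absurd h' (by decide)⟩
    · have hk : κ2 ((k, 0), ℓ) = 1 := by simp [hκ2, h]
      rw [hk]
      exact ⟨fun h' => absurd h' (by decide), fun _ => (hcb1 k ℓ h).1⟩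
    · have hk : κ2 ((k, 1), ℓ) = 1 := by simp [hκ2, h]
      rw [hk]
      exact ⟨fun h' => absurd h' (by decide), fun _ => (hcb0 k ℓ h).2⟩
    · have hk : κ2 ((k, 1), ℓ) = 0 := by simp [hκ2, h]
      rw [hk]
      exact ⟨fun _ => (hcb1 k ℓ h).2, fun h' => absurd h' (by decide)⟩
  set κ' : Fin (Module.finrank ℚ (bettiCohomology A.X 1)) → Fin 2 := fun m => κ2 (φι m) with hκ'
  -- letters
  set ρ := ofRatClassBaseChangeEquiv hX 1 with hρ
  set v : Module.Basis _ ℂ (complexBetti A.X 1) := cbσ.map ρ with hv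
  set eL : Module.Basis _ ℂ (complexBetti A.X 1) := eC.map ρ with heL
  have heLQ : ∀ i, IsRationalClass (eL i) := fun i => by
    rw [heL, Module.Basis.map_apply, heC, Algebra.TensorProduct.basis_apply, hρ,
      ofRatClassBaseChangeEquiv_apply, ofRatClassBaseChange_tmul, one_smul]
    exact isRationalClass_ofRatClass _
  have hv_apply : ∀ m, v m = ofRatClassBaseChange (Motives.ComplexPoints A.X) 1 (cb (φι m)) := fun m => by
    rw [hv, Module.Basis.map_apply, hcbσ, hρ, ofRatClassBaseChangeEquiv_apply]
  have hv0 : ∀ m, κ' m = 0 → IsOfHodgeType A.dim A.X 1 1 0 (v m) := by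
    intro m hm
    rw [hv_apply, ← BettiUniverse.mem_hodge_piece_iff hHD hI hX (k := 1) (p := 1) (q := 0) rfl]
    exact (hkind (φι m)).1 hm
  have hv1 : ∀ m, κ' m = 1 → IsOfHodgeType A.dim A.X 1 0 1 (v m) := by
    intro m hm
    rw [hv_apply, ← BettiUniverse.mem_hodge_piece_iff hHD hI hX (k := 1) (p := 0) (q := 1) rfl]
    exact (hkind (φι m)).2 hm
  -- (α) an antisymmetric kind-balanced coefficient function in the adapted letters
  obtain ⟨ax, hax_bal, hax_anti, hcax⟩ := hg.exists_antisymm_kindBalanced_wordEval_eq v κ' hv0 hv1 hp hc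
  -- the change of letters to the rational letters
  set G : Matrix _ _ ℂ := eC.toMatrix cbσ with hG
  set G' : Matrix _ _ ℂ := cbσ.toMatrix eC with hG'
  have hG'G : G' * G = 1 := cbσ.toMatrix_mul_toMatrix_flip eC
  have hve : ∀ m, v m = ∑ i, G i m • eL i := fun m => by
    simp only [hv, heL, Module.Basis.map_apply, ← map_smul, ← map_sum]
    congr 1
    exact (eC.sum_toMatrix_smul_self (v := ⇑cbσ) (j := m)).symm
  have hletters : ∀ j m, avLetters g v (j, m) = ∑ i, G i m • avLetters g eL (j, i) :=
    avLetters_baseChange g G hve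
  set aE := colourChangeAt (fun _ : Fin n => G) ax with haE
  have haE_anti : IsAntisymm aE := hax_anti.colourChangeAt _
  have hcaE : wordEval F (avLetters g eL) aE = c := by
    rw [haE, ← wordEval_eq_wordEval_colourChangeAt F (fun _ : Fin n => G) hletters ax, hcax]
  -- rationality of `aE`
  obtain ⟨q, hq⟩ := hg.exists_rat_wordEval_eq eL heLQ hcQ
  obtain ⟨q', -, haEq⟩ := haE_anti.exists_eq_algebraMap_of_wordEval_eq hFinj (hg.letterBasis eL)
    (q := q) (by rw [AVSlots.coe_letterBasis, hcaE, hFdef, hq])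
  have hslice_e : ∀ u, wordSlice aE u = wordRepAt ℂ (fun _ : Fin (2 * p) => G) (wordSlice ax u) :=
    fun u => wordSlice_colourChangeAt (fun _ : Fin n => G) ax u
  -- the Hodge operator `Θ`: `diag(±1)` in the adapted letters
  obtain ⟨Θ, hΘ⟩ := exists_hodgeTheta (BettiUniverse.hodge hHD (AbelianVariety.isSmoothProjective_holds (A := A)) 1)
  obtain ⟨-, -, hΘ10, hΘ01, -⟩ :=
    UnitaryTheta.theta_facts (BettiUniverse.hodge hHD (AbelianVariety.isSmoothProjective_holds (A := A)) 1)
      hn1 heff hΘ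
  have hΘb : ∀ m, Θ (cbσ m) = (if κ' m = 0 then (1 : ℂ) else -1) • cbσ m := by
    intro m
    rw [hcbσ]
    rcases fin2_cases' (κ' m) with h0 | h1'
    · rw [h0, if_pos rfl, one_smul]
      exact hΘ10 _ ((hkind (φι m)).1 h0)
    · rw [h1', if_neg one_ne_zero, neg_one_smul]
      exact hΘ01 _ ((hkind (φι m)).2 h1')
  have hΘcb : LinearMap.toMatrix cbσ cbσ Θ = kindDiag κ' := by
    ext i m
    rw [LinearMap.toMatrix_apply, hΘb, map_smul, Module.Basis.repr_self, Finsupp.smul_apply,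
      Finsupp.single_apply, kindDiag, Matrix.diagonal_apply, smul_eq_mul, mul_ite, mul_one, mul_zero]
    by_cases him : i = m
    · subst him; rw [if_pos rfl]
    · rw [if_neg (Ne.symm him), if_neg him]
  have hJG : LinearMap.toMatrix eC eC Θ * G = G * kindDiag κ' := by
    rw [← hΘcb, hG, linearMap_toMatrix_mul_basis_toMatrix, basis_toMatrix_mul_linearMap_toMatrix]
  have hΘq : ∀ u : Fin (2 * p) → Fin n, wordDerAt ℂ (fun _ : Fin (2 * p) => LinearMap.toMatrix eC eC Θ)
      (wordSlice (fun w => algebraMap ℚ ℂ (q' w)) u) = 0 := by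
    intro u
    rw [← haEq, hslice_e]
    refine wordDerAt_wordRepAt_eq_zero_of_mul_eq ℂ (fun _ : Fin (2 * p) => G) (fun _ => hJG) ?_
    rw [wordDerAt_const]
    exact wordDer_kindDiag_wordSlice_eq_zero κ' hax_bal u
  -- structure constants of `ψ_ℂ` and `φ_ℂ` in the adapted basis
  set ψC := ψ.form.baseChange ℂ with hψC
  have hswap : ∀ x y, ψC y x = -ψC x y := fun x y => by
    rw [hψC, ψ.form_baseChange_swap, show (((1 : ℕ) : ℤ)).negOnePow = -1 from Int.negOnePow_one]
    simp
  have hdual_same : ∀ k i j, ψC (cb ((k, 0), i)) (cb ((k, 1), j)) = if i = j then 1 else 0 := fun k i j => by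
    rw [hψC, hdual]; simp
  have hswap_same : ∀ k i j, ψC (cb ((k, 1), i)) (cb ((k, 0), j)) = -(if j = i then 1 else 0) := fun k i j => by
    rw [hswap, hdual_same]
  have hpair0 : ∀ k₁ k₂ (t₁ t₂ : Fin 2) i j, k₁ ≠ k₂ → ψC (cb ((k₁, t₁), i)) (cb ((k₂, t₂), j)) = 0 := by
    intro k₁ k₂ t₁ t₂ i j hk
    rcases fin2_cases' t₁ with rfl | rfl <;> rcases fin2_cases' t₂ with rfl | rfl
    · exact hiso k₁ k₂ 0 i j
    · rw [hψC, hdual, if_neg (fun h => hk h.1)]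
    · rw [hswap, hψC, hdual, if_neg (fun h => hk h.1.symm), neg_zero]
    · exact hiso k₁ k₂ 1 i j
  set ev : ι × Fin 2 → ℂ := fun kt => if kt.2 = 0 then μ kt.1 else starRingEnd ℂ (μ kt.1) with hev
  have hφcb : ∀ (kt : ι × Fin 2) ℓ, φ.baseChange ℂ (cb (kt, ℓ)) = ev kt • cb (kt, ℓ) := by
    rintro ⟨k, t⟩ ℓ
    rcases fin2_cases' t with rfl | rfl
    · simp only [hev, if_pos rfl]; exact Module.End.mem_eigenspace_iff.1 (hcbW k ℓ)
    · simp only [hev, if_neg one_ne_zero]; exact Module.End.mem_eigenspace_iff.1 (hcbW' k ℓ)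
  -- the invariance of every slice under the typed differentials of colour `k`, via THEOREM L″
  have key : ∀ (k : ι) (X : Matrix (Fin n₀) (Fin n₀) ℂ) (u : Fin (2 * p) → Fin n),
      wordDerAt ℂ (fun _ : Fin (2 * p) => blockLiftGen φι (fun kt : ι × Fin 2 =>
        if kt.1 = k then (if kt.2 = 0 then X else -Xᵀ) else 0)) (wordSlice ax u) = 0 := by
    intro k X u
    set Nf : ι × Fin 2 → Matrix (Fin n₀) (Fin n₀) ℂ := fun kt =>
      if kt.1 = k then (if kt.2 = 0 then X else -Xᵀ) else 0 with hNf
    have hNf0 : Nf (k, 0) = X := by simp [hNf]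
    have hNf1 : Nf (k, 1) = -Xᵀ := by simp [hNf]
    have hNfne : ∀ k' t, k' ≠ k → Nf (k', t) = 0 := fun k' t hk' => by simp [hNf, hk']
    set Y := Matrix.toLin cbσ cbσ (blockLiftGen φι Nf) with hYdef
    have hYcb : ∀ (kt : ι × Fin 2) ℓ, Y (cb (kt, ℓ)) = ∑ r, Nf kt r ℓ • cb (kt, r) :=
      fun kt ℓ => toLin_blockLiftGen_apply φι cbσ (⇑cb) hcbσ Nf kt ℓ
    have hYφ : Y * φ.baseChange ℂ = φ.baseChange ℂ * Y := by
      refine cb.ext fun x => ?_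
      obtain ⟨kt, ℓ⟩ := x
      rw [Module.End.mul_apply, Module.End.mul_apply, hφcb, map_smul, hYcb, map_sum, Finset.smul_sum]
      exact Finset.sum_congr rfl fun r _ => by rw [map_smul, hφcb, smul_comm]
    have hYskew : ∀ x y, ψC (Y x) y + ψC x (Y y) = 0 := by
      have hB : ψC ∘ₗ Y + ψC.compl₂ Y = 0 := by
        refine LinearMap.BilinForm.ext_basis cb fun x₁ x₂ => ?_
        obtain ⟨⟨k₁, t₁⟩, i⟩ := x₁
        obtain ⟨⟨k₂, t₂⟩, j⟩ := x₂
        rw [LinearMap.add_apply, LinearMap.add_apply, LinearMap.comp_apply, LinearMap.compl₂_apply,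
          LinearMap.zero_apply, LinearMap.zero_apply, hYcb, hYcb, map_sum, LinearMap.sum_apply, map_sum]
        simp only [map_smul, LinearMap.smul_apply, smul_eq_mul]
        by_cases hk12 : k₁ = k₂
        · subst hk12
          by_cases hk1 : k₁ = k
          · subst hk1
            rcases fin2_cases' t₁ with rfl | rfl <;> rcases fin2_cases' t₂ with rfl | rfl
            · simp [hiso]
            · simp [hNf0, hNf1, hdual_same, Matrix.neg_apply, Matrix.transpose_apply, mul_ite, Finset.sum_ite_eq,
                Finset.sum_ite_eq']
            · simp [hNf0, hNf1, hswap_same, Matrix.neg_apply, Matrix.transpose_apply, mul_ite, Finset.sum_ite_eq,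
                Finset.sum_ite_eq']
            · simp [hiso]
          · simp [hNfne k₁ t₁ hk1, hNfne k₁ t₂ hk1]
        · simp [hpair0 k₁ k₂ t₁ t₂ _ _ hk12]
      intro x y
      have h := LinearMap.congr_fun (LinearMap.congr_fun hB x) y
      simpa only [LinearMap.add_apply, LinearMap.comp_apply, LinearMap.compl₂_apply, LinearMap.zero_apply]
        using h
    have hL := UnitaryTheta.wordDerAt_eq_zero_of_commute_of_skew_of_hodgeLieC
      (BettiUniverse.hodge hHD (AbelianVariety.isSmoothProjective_holds (A := A)) 1) ψ hU eQ q' hΘ hΘq hYφ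
      hYskew u
    rw [← haEq, hslice_e] at hL
    have hYG : ∀ _t : Fin (2 * p), LinearMap.toMatrix eC eC Y * G = G * LinearMap.toMatrix cbσ cbσ Y :=
      fun _ => by rw [hG, linearMap_toMatrix_mul_basis_toMatrix, basis_toMatrix_mul_linearMap_toMatrix]
    have hblk : LinearMap.toMatrix cbσ cbσ Y = blockLiftGen φι Nf := by
      rw [hYdef, LinearMap.toMatrix_toLin]
    have h3 : wordRepAt ℂ (fun _ : Fin (2 * p) => G)
        (wordDerAt ℂ (fun _ : Fin (2 * p) => blockLiftGen φι Nf) (wordSlice ax u)) = 0 := by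
      rw [← hblk, wordRepAt_wordDerAt_of_mul_eq ℂ (fun _ : Fin (2 * p) => G) hYG, hL]
    exact wordRepAt_injective ℂ (g := fun _ : Fin (2 * p) => G) (g' := fun _ : Fin (2 * p) => G')
      (funext fun _ => hG'G) (by rw [h3, map_zero])
  -- the coefficient function, refined to slot-and-(colour, type) letters
  refine ⟨placeRefineGen φι ax, ?_, fun U k X => ?_⟩
  · rw [← hcax]
    have hx : (fun x : (Fin n × (ι × Fin 2)) × Fin n₀ => avLetters g v (x.1.1, φι.symm (x.1.2, x.2))) =
        fun x => avLetters g (fun tl : (ι × Fin 2) × Fin n₀ =>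
          ofRatClassBaseChange (Motives.ComplexPoints A.X) 1 (cb tl)) (x.1.1, (x.1.2, x.2)) := by
      funext x
      rw [avLetters_apply, avLetters_apply, hv_apply, Equiv.apply_symm_apply]
    rw [← hx]
    exact wordEval_placeRefineGen F φι (avLetters g v) ax
  · exact wordDerAt_placeRefineGen_eq_zero φι
      (fun kt : ι × Fin 2 => if kt.1 = k then (if kt.2 = 0 then X else -Xᵀ) else 0) (key k X) U


end CMInvariance

end Literature.AlgebraicGeometry.HodgeTheory

end
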